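import Summits.Ventures.PercRepro.RankLevelSetContractMono
import Summits.Ventures.PercRepro.RankLevelSetB

/-!
# PercRepro — C-037 AT `q = 1` ON CORES IS A THEOREM (night-1, gen 7)

For a SIMPLE, COLOOP-FREE matroid of rank `p ≥ 3` on `n ≥ p + 1` elements and EVERY non-loop `e`,
the contraction monotonicity of the C-025 slack holds at `(p, 1)`:
  `σ_{M ／ {e}}(p − 1, 1) ≤ σ_M(p, 1)`   (`contractMono_q_one`; `slack` of RankLevelSetContractMono).
Proof (proofs/NIGHT1-MC.md §5): `#U_M(p,1) ≤ n` (p3's `ncard_U_one_le_of_eRank_eq`: a member of `U(p,1)` is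
`E ∖ {x}`); `#Y_M(p,1) = #Y_{M∖e}(p,1) + #Y_{M/e}(p−1,1) + W_1(M/e)` (the cell's identity (6.1) and the split
of the contraction's count at level `1`); `#Y_{M∖e}(p,1) ≥ Σ_{1<j<p} C(n−1, j)` (every `j`-subset of `E ∖ e`
with `2 ≤ j ≤ p−1` has rank in `[2, p−1]`); `W_1(M/e) ≥ n − 1` (the singletons) and `#U_{M/e}(p−1,1) ≥ n − 1`
(`A′ = E ∖ {e, x}`: `E ∖ {x}` spans since `x` is not a coloop); and the binomial inequality
`n·Φ(p,1) ≤ Σ_{1<j<p} C(n−1,j) + (n−1)(1 + Φ(p−1,1))` (`QOne.binom_ineq`, via `S(p) = 2T(p) + 2p` and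
`Σ_{1<j<p} C(m,j) ≥ (T(p) + p)(m + 1 − p)` for `m ≥ p`).  With module 3 this re-derives Theorem B (C-025 at
`q = 1`) through the (MC)-induction.  Axioms: standard.
-/

open scoped Matroid

namespace PercRepro

namespace QOne

open Finset

/-- `Ioo 1 p = Ico 2 p` in `ℕ`. -/
lemma Ioo_one_eq_Ico (p : ℕ) : Finset.Ioo 1 p = Finset.Ico 2 p := by
  ext u; simp only [Finset.mem_Ioo, Finset.mem_Ico]; omega

/-- Termwise Pascal on `Ioo 1 p`: `Σ C(m+1,j) = Σ C(m,j) + Σ C(m,j-1)`. -/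
lemma sum_choose_succ_Ioo (m p : ℕ) :
    ∑ j ∈ Finset.Ioo 1 p, Nat.choose (m + 1) j =
      ∑ j ∈ Finset.Ioo 1 p, Nat.choose m j + ∑ j ∈ Finset.Ioo 1 p, Nat.choose m (j - 1) := by
  rw [← Finset.sum_add_distrib]
  apply Finset.sum_congr rfl
  intro j hj
  rw [Finset.mem_Ioo] at hj
  obtain ⟨i, rfl⟩ : ∃ i, j = i + 1 := ⟨j - 1, by omega⟩
  rw [Nat.choose_succ_succ', Nat.add_sub_cancel]
  ring

/-- The shifted sum: `Σ_{1<j<p} C(m,j-1) = C(m,1) + Σ_{1<i<p-1} C(m,i)` for `p ≥ 3`. -/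
lemma sum_choose_shift (m p : ℕ) (hp : 3 ≤ p) :
    ∑ j ∈ Finset.Ioo 1 p, Nat.choose m (j - 1) = Nat.choose m 1 + ∑ i ∈ Finset.Ioo 1 (p - 1), Nat.choose m i := by
  rw [Ioo_one_eq_Ico, Ioo_one_eq_Ico, Finset.sum_Ico_eq_sum_range, Finset.sum_Ico_eq_sum_range]
  obtain ⟨k, rfl⟩ : ∃ k, p = k + 3 := ⟨p - 3, by omega⟩
  have h1 : k + 3 - 2 = k + 1 := by omega
  have h2 : k + 3 - 1 - 2 = k := by omega
  rw [h1, h2, Finset.sum_range_succ']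
  simp only [show 2 + 0 - 1 = 1 from rfl]
  have : ∀ i, 2 + (i + 1) - 1 = 2 + i := fun i => by omega
  simp only [this]
  ring

/-- Splitting the top term: `Σ_{1<j<p} C(m,j) = Σ_{1<j<p-1} C(m,j) + C(m,p-1)` for `p ≥ 3`. -/
lemma sum_choose_split_top (m p : ℕ) (hp : 3 ≤ p) :
    ∑ j ∈ Finset.Ioo 1 p, Nat.choose m j = ∑ j ∈ Finset.Ioo 1 (p - 1), Nat.choose m j + Nat.choose m (p - 1) := by
  rw [Ioo_one_eq_Ico, Ioo_one_eq_Ico]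
  obtain ⟨k, rfl⟩ : ∃ k, p = k + 3 := ⟨p - 3, by omega⟩
  have h1 : k + 3 - 1 = k + 2 := by omega
  rw [h1, Finset.sum_Ico_succ_top (by omega)]

/-- `S p = 2 T p + 2 p` (Pascal), `p ≥ 3`. -/
lemma S_eq (p : ℕ) (hp : 3 ≤ p) :
    ∑ u ∈ Finset.Ioo 1 p, Nat.choose (p + 1) u =
      2 * (∑ u ∈ Finset.Ioo 1 (p - 1), Nat.choose p u) + 2 * p := by
  rw [sum_choose_succ_Ioo, sum_choose_shift p p hp, sum_choose_split_top p p hp, Nat.choose_one_right]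
  have hpp : Nat.choose p (p - 1) = p := by
    obtain ⟨k, rfl⟩ : ∃ k, p = k + 1 := ⟨p - 1, by omega⟩
    rw [Nat.add_sub_cancel, Nat.choose_succ_self_right]
  rw [hpp]
  ring

/-- The lower bound `A p m ≥ (T p + p)·(m + 1 - p)` for `m ≥ p`, `p ≥ 3`. -/
lemma A_ge (p : ℕ) (hp : 3 ≤ p) : ∀ m, p ≤ m →
    (∑ u ∈ Finset.Ioo 1 (p - 1), Nat.choose p u + p) * (m + 1 - p) ≤ ∑ j ∈ Finset.Ioo 1 p, Nat.choose m j := by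
  intro m hm
  induction m, hm using Nat.le_induction with
  | base =>
    rw [sum_choose_split_top p p hp, Nat.add_sub_cancel_left, mul_one]
    have hpp : Nat.choose p (p - 1) = p := by
      obtain ⟨k, rfl⟩ : ∃ k, p = k + 1 := ⟨p - 1, by omega⟩
      rw [Nat.add_sub_cancel, Nat.choose_succ_self_right]
    rw [hpp]
  | succ m hm ih =>
    rw [sum_choose_succ_Ioo, sum_choose_shift m p hp, Nat.choose_one_right]
    have hT : ∑ u ∈ Finset.Ioo 1 (p - 1), Nat.choose p u ≤ ∑ i ∈ Finset.Ioo 1 (p - 1), Nat.choose m i :=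
      Finset.sum_le_sum (fun i _ => Nat.choose_le_choose i hm)
    have h1 : m + 1 + 1 - p = (m + 1 - p) + 1 := by omega
    rw [h1, mul_add, mul_one]
    omega

/-- **The binomial inequality of C-037 at `q = 1`** (in `ℕ`, cross-multiplied): for `p ≥ 3` and `n ≥ p + 1`,
`n·S·p ≤ p(p+1)·A(n-1) + (n-1)(p+1)(p + T)`. -/
theorem binom_ineq (p n : ℕ) (hp : 3 ≤ p) (hn : p + 1 ≤ n) :
    n * (∑ u ∈ Finset.Ioo 1 p, Nat.choose (p + 1) u) * p ≤
      p * (p + 1) * (∑ j ∈ Finset.Ioo 1 p, Nat.choose (n - 1) j) +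
        (n - 1) * (p + 1) * (p + ∑ u ∈ Finset.Ioo 1 (p - 1), Nat.choose p u) := by
  set T := ∑ u ∈ Finset.Ioo 1 (p - 1), Nat.choose p u with hT
  have hS := S_eq p hp
  rw [hS]
  have hA := A_ge p hp (n - 1) (by omega)
  have h1 : n - 1 + 1 - p = n - p := by omega
  rw [h1] at hA
  -- n * (2T + 2p) * p ≤ p(p+1)(T+p)(n-p) + (n-1)(p+1)(p+T)
  have key : n * (2 * T + 2 * p) * p ≤ p * (p + 1) * ((T + p) * (n - p)) + (n - 1) * (p + 1) * (p + T) := by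
    obtain ⟨k, rfl⟩ : ∃ k, n = p + 1 + k := ⟨n - p - 1, by omega⟩
    have e1 : p + 1 + k - p = k + 1 := by omega
    have e2 : p + 1 + k - 1 = p + k := by omega
    rw [e1, e2]
    have hid : p * (p + 1) * ((T + p) * (k + 1)) + (p + k) * (p + 1) * (p + T) =
        (p + 1 + k) * (2 * T + 2 * p) * p + (T + p) * k * (p * p + 1) := by ring
    rw [hid]
    exact Nat.le_add_right _ _
  calc n * (2 * T + 2 * p) * p ≤ p * (p + 1) * ((T + p) * (n - p)) + (n - 1) * (p + 1) * (p + T) := key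
    _ ≤ p * (p + 1) * (∑ j ∈ Finset.Ioo 1 p, Nat.choose (n - 1) j) + (n - 1) * (p + 1) * (p + T) := by
        gcongr

end QOne

namespace Matroid

open Set Finset

variable {α : Type} {M : _root_.Matroid α}

/-- `#U_M(p,1) ≤ |E|` for a simple matroid of rank `p`. -/
lemma topCount_one_le_ncard [M.Finite] (hsimple : ∀ T ⊆ M.E, T.encard ≤ 2 → M.Indep T) {p : ℕ}
    (hR : M.eRank = (p : ℕ∞)) : topCount M p 1 ≤ M.E.ncard := by
  unfold topCount
  exact le_trans (ncard_U_one_le_of_eRank_eq hsimple hR) (Set.ncard_le_ncard Set.sdiff_subset M.ground_finite)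

/-- The split of the middle count at the bottom level: `#Y(p, 0) = #Y(p, 1) + W_1` for `p ≥ 2`. -/
lemma midCount_zero_eq [M.Finite] {p : ℕ} (hp : 2 ≤ p) :
    midCount M p 0 = midCount M p 1 + {A : Set α | A ⊆ M.E ∧ M.eRk A = ((1 : ℕ) : ℕ∞)}.ncard := by
  unfold midCount
  set S := {A : Set α | A ⊆ M.E ∧ ((0 : ℕ) : ℕ∞) < M.eRk A ∧ M.eRk A < (p : ℕ∞)} with hS
  have hSfin : S.Finite := M.ground_finite.finite_subsets.subset (fun _ hA => hA.1)
  rw [ncard_split hSfin (fun A => ((1 : ℕ) : ℕ∞) < M.eRk A)]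
  congr 1
  · congr 1
    ext A
    simp only [hS, Set.mem_setOf_eq]
    constructor
    · rintro ⟨⟨hA, -, hlt⟩, h1⟩; exact ⟨hA, h1, hlt⟩
    · rintro ⟨hA, h1, hlt⟩
      exact ⟨⟨hA, lt_of_lt_of_le (by norm_num) h1.le, hlt⟩, h1⟩
  · congr 1
    ext A
    simp only [hS, Set.mem_setOf_eq, not_lt]
    constructor
    · rintro ⟨⟨hA, h0, -⟩, h1⟩
      refine ⟨hA, le_antisymm h1 ?_⟩
      have h0' : (0 : ℕ∞) < M.eRk A := by simpa using h0
      exact Order.one_le_iff_pos.mpr h0'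
    · rintro ⟨hA, h1⟩
      refine ⟨⟨hA, ?_, ?_⟩, h1.le⟩
      · rw [h1]; norm_num
      · rw [h1]; exact_mod_cast (show 1 < p by omega)

/-- Every `j`-subset of `E ∖ {e}` with `2 ≤ j ≤ p − 1` is in `Y_{M∖e}(p, 1)` (simple `M`), so
`#Y_{M∖e}(p,1) ≥ Σ_{1<j<p} C(n − 1, j)`. -/
lemma sum_choose_le_midCount_delete [M.Finite] (hsimple : ∀ T ⊆ M.E, T.encard ≤ 2 → M.Indep T)
    (e : α) (p : ℕ) :
    ∑ j ∈ Finset.Ioo 1 p, Nat.choose (M.E \ {e}).ncard j ≤ midCount (M ＼ {e}) p 1 := by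
  classical
  set E' : Set α := M.E \ {e} with hE'
  have hE'fin : E'.Finite := M.ground_finite.subset Set.sdiff_subset
  set F : Finset (Finset α) := (Finset.Ioo 1 p).disjiUnion (fun j => hE'fin.toFinset.powersetCard j)
    (hE'fin.toFinset.pairwise_disjoint_powersetCard.set_pairwise _) with hF
  have hFcard : F.card = ∑ j ∈ Finset.Ioo 1 p, Nat.choose E'.ncard j := by
    rw [hF, Finset.card_disjiUnion]
    apply Finset.sum_congr rfl
    intro j _
    rw [Finset.card_powersetCard, Set.ncard_eq_toFinset_card E' hE'fin]
  -- the coercions of the members of `F` lie in `Y_{M∖e}(p,1)`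
  have hmem : ∀ s ∈ F, ((s : Set α) ⊆ (M ＼ {e}).E ∧ ((1 : ℕ) : ℕ∞) < (M ＼ {e}).eRk (s : Set α) ∧
      (M ＼ {e}).eRk (s : Set α) < (p : ℕ∞)) := by
    intro s hs
    rw [hF, Finset.mem_disjiUnion] at hs
    obtain ⟨j, hj, hsj⟩ := hs
    rw [Finset.mem_powersetCard] at hsj
    rw [Finset.mem_Ioo] at hj
    have hsE' : (s : Set α) ⊆ E' := by
      intro x hx
      have := hsj.1 hx
      rwa [Set.Finite.mem_toFinset] at this
    have hsE : (s : Set α) ⊆ M.E := hsE'.trans Set.sdiff_subset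
    have hrk : (M ＼ {e}).eRk (s : Set α) = M.eRk (s : Set α) := delete_singleton_eRk_eq hsE'
    refine ⟨by rw [Matroid.delete_ground]; exact hsE', ?_, ?_⟩
    · -- two distinct elements of `s` give rank `≥ 2`
      obtain ⟨a, ha, b, hb, hab⟩ := Finset.one_lt_card.1 (by omega : 1 < s.card)
      have hpair : ({a, b} : Set α) ⊆ (s : Set α) := by
        intro x hx
        rcases hx with rfl | rfl
        · exact ha
        · exact hb
      have hind : M.Indep ({a, b} : Set α) :=
        hsimple _ (hpair.trans hsE) (by rw [Set.encard_pair hab])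
      have h2 : M.eRk ({a, b} : Set α) = 2 := by rw [hind.eRk_eq_encard, Set.encard_pair hab]
      rw [hrk]
      calc ((1 : ℕ) : ℕ∞) < 2 := by norm_num
        _ = M.eRk ({a, b} : Set α) := h2.symm
        _ ≤ M.eRk (s : Set α) := M.eRk_mono hpair
    · rw [hrk]
      calc M.eRk (s : Set α) ≤ (s : Set α).encard := M.eRk_le_encard _
        _ = (s.card : ℕ∞) := Set.encard_coe_eq_coe_finsetCard s
        _ < (p : ℕ∞) := by exact_mod_cast (show s.card < p by omega)
  unfold midCount
  set Y := {A : Set α | A ⊆ (M ＼ {e}).E ∧ ((1 : ℕ) : ℕ∞) < (M ＼ {e}).eRk A ∧ (M ＼ {e}).eRk A < (p : ℕ∞)} with hY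
  have hYfin : Y.Finite := (M ＼ {e}).ground_finite.finite_subsets.subset (fun _ hA => hA.1)
  have hsub : ((F.image (fun s : Finset α => (s : Set α)) : Finset (Set α)) : Set (Set α)) ⊆ Y := by
    intro A hA
    rw [Finset.coe_image] at hA
    obtain ⟨s, hs, rfl⟩ := hA
    exact hmem s hs
  calc ∑ j ∈ Finset.Ioo 1 p, Nat.choose E'.ncard j = F.card := hFcard.symm
    _ = (F.image (fun s : Finset α => (s : Set α))).card :=
        (Finset.card_image_of_injective F Finset.coe_injective).symm
    _ = ((F.image (fun s : Finset α => (s : Set α)) : Finset (Set α)) : Set (Set α)).ncard :=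
        (Set.ncard_coe_finset _).symm
    _ ≤ Y.ncard := Set.ncard_le_ncard hsub hYfin

/-- Rank of a singleton in the contraction by a non-loop `e` of a simple matroid: `r_{M/e}({x}) = 1`. -/
lemma contract_eRk_singleton_eq_one [M.Finite] (hsimple : ∀ T ⊆ M.E, T.encard ≤ 2 → M.Indep T)
    {e x : α} (he : M.Indep {e}) (hx : x ∈ M.E \ {e}) : (M ／ {e}).eRk {x} = ((1 : ℕ) : ℕ∞) := by
  have heE : e ∈ M.E := he.subset_ground (Set.mem_singleton e)
  have hxe : e ≠ x := fun h => hx.2 (by rw [h]; exact Set.mem_singleton x)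
  have hind : M.Indep ({e, x} : Set α) :=
    hsimple _ (Set.insert_subset heE (Set.singleton_subset_iff.2 hx.1)) (by rw [Set.encard_pair hxe])
  have h2 : M.eRk (insert e {x}) = ((1 + 1 : ℕ) : ℕ∞) := by
    rw [hind.eRk_eq_encard, Set.encard_pair hxe]; rfl
  have h := contract_singleton_eRk_add_one he (X := {x}) (Set.singleton_subset_iff.2 hx)
  rw [h2] at h
  exact add_one_eq_coe_succ_iff.1 h

/-- `W_1(M/e) ≥ n − 1`: the singletons of `E ∖ {e}`. -/
lemma ncard_le_levelOne_contract [M.Finite] (hsimple : ∀ T ⊆ M.E, T.encard ≤ 2 → M.Indep T)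
    {e : α} (he : M.Indep {e}) :
    (M.E \ {e}).ncard ≤ {A : Set α | A ⊆ (M ／ {e}).E ∧ (M ／ {e}).eRk A = ((1 : ℕ) : ℕ∞)}.ncard := by
  have hE'fin : (M.E \ {e}).Finite := M.ground_finite.subset Set.sdiff_subset
  set W := {A : Set α | A ⊆ (M ／ {e}).E ∧ (M ／ {e}).eRk A = ((1 : ℕ) : ℕ∞)} with hW
  have hWfin : W.Finite := (M ／ {e}).ground_finite.finite_subsets.subset (fun _ hA => hA.1)
  have hinj : Set.InjOn (fun x : α => ({x} : Set α)) (M.E \ {e}) := fun x _ y _ h => Set.singleton_injective h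
  have hsub : (fun x : α => ({x} : Set α)) '' (M.E \ {e}) ⊆ W := by
    rintro A ⟨x, hx, rfl⟩
    refine ⟨by rw [Matroid.contract_ground]; exact Set.singleton_subset_iff.2 hx, ?_⟩
    exact contract_eRk_singleton_eq_one hsimple he hx
  calc (M.E \ {e}).ncard = ((fun x : α => ({x} : Set α)) '' (M.E \ {e})).ncard :=
        hinj.ncard_image.symm
    _ ≤ W.ncard := Set.ncard_le_ncard hsub hWfin

/-- For a non-coloop `x` of a matroid of rank `p`: `r(E ∖ {x}) = p`. -/
lemma eRk_ground_sdiff_singleton_of_not_isColoop [M.Finite] {p : ℕ} (hR : M.eRank = (p : ℕ∞)) {x : α}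
    (hx : x ∈ M.E) (hcol : ¬ M.IsColoop x) : M.eRk (M.E \ {x}) = (p : ℕ∞) := by
  rw [Matroid.isColoop_iff_notMem_closure_compl hx, not_not] at hcol
  have hcl : M.closure (M.E \ {x}) = M.E := by
    refine (M.closure_subset_ground _).antisymm (fun y hy => ?_)
    by_cases hyx : y = x
    · rw [hyx]; exact hcol
    · exact M.subset_closure (M.E \ {x}) Set.sdiff_subset ⟨hy, hyx⟩
  have h := M.eRk_closure_eq (M.E \ {x})
  rw [hcl, Matroid.eRk_ground, hR] at h
  exact h.symm

/-- `#U_{M/e}(p − 1, 1) ≥ n − 1`: the sets `E ∖ {e, x}` for `x ≠ e` (simple, coloop-free, rank `p ≥ 1`). -/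
lemma ncard_le_topCount_contract [M.Finite] (hsimple : ∀ T ⊆ M.E, T.encard ≤ 2 → M.Indep T)
    {p : ℕ} (hp : 1 ≤ p) (hR : M.eRank = (p : ℕ∞)) (hcol : ∀ x, ¬ M.IsColoop x)
    {e : α} (he : M.Indep {e}) :
    (M.E \ {e}).ncard ≤ topCount (M ／ {e}) (p - 1) 1 := by
  have heE : e ∈ M.E := he.subset_ground (Set.mem_singleton e)
  set E' : Set α := M.E \ {e} with hE'
  have hE'fin : E'.Finite := M.ground_finite.subset Set.sdiff_subset
  unfold topCount
  set U := {A : Set α | A ⊆ (M ／ {e}).E ∧ (M ／ {e}).eRk A = ((p - 1 : ℕ) : ℕ∞) ∧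
      (M ／ {e}).eRk ((M ／ {e}).E \ A) = ((1 : ℕ) : ℕ∞)} with hU
  have hUfin : U.Finite := (M ／ {e}).ground_finite.finite_subsets.subset (fun _ hA => hA.1)
  have hinj : Set.InjOn (fun x : α => E' \ {x}) E' := by
    intro x hx y _ hxy
    have hxy' : E' \ {x} = E' \ {y} := hxy
    by_contra hne
    have hmem : x ∈ E' \ {y} := ⟨hx, fun h => hne h⟩
    rw [← hxy'] at hmem
    exact hmem.2 rfl
  have hsub : (fun x : α => E' \ {x}) '' E' ⊆ U := by
    rintro A ⟨x, hx, rfl⟩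
    have hxE : x ∈ M.E := hx.1
    have hxe : x ≠ e := hx.2
    refine ⟨by rw [Matroid.contract_ground]; exact Set.sdiff_subset, ?_, ?_⟩
    · -- `r_{M/e}(E' ∖ {x}) + 1 = r_M(E ∖ {x}) = p`
      have hsub' : E' \ {x} ⊆ M.E \ {e} := Set.sdiff_subset
      have h := contract_singleton_eRk_add_one he hsub'
      have hins : insert e (E' \ {x}) = M.E \ {x} := by
        ext y
        simp only [hE', Set.mem_insert_iff, Set.mem_sdiff, Set.mem_singleton_iff]
        constructor
        · rintro (rfl | ⟨⟨hyE, -⟩, hyx⟩)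
          · exact ⟨heE, hxe.symm⟩
          · exact ⟨hyE, hyx⟩
        · rintro ⟨hyE, hyx⟩
          by_cases hye : y = e
          · exact Or.inl hye
          · exact Or.inr ⟨⟨hyE, hye⟩, hyx⟩
      rw [hins, eRk_ground_sdiff_singleton_of_not_isColoop hR hxE (hcol x)] at h
      obtain ⟨p', rfl⟩ : ∃ p', p = p' + 1 := ⟨p - 1, by omega⟩
      rw [Nat.add_sub_cancel]
      exact add_one_eq_coe_succ_iff.1 h
    · have hcompl : (M ／ {e}).E \ (E' \ {x}) = {x} := by
        rw [Matroid.contract_ground]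
        exact sdiff_sdiff_eq_self (Set.singleton_subset_iff.2 hx)
      rw [hcompl]
      exact contract_eRk_singleton_eq_one hsimple he hx
  calc E'.ncard = ((fun x : α => E' \ {x}) '' E').ncard := hinj.ncard_image.symm
    _ ≤ U.ncard := Set.ncard_le_ncard hsub hUfin

/-- `Φ(p, 1)` and `Φ(p − 1, 1)` as quotients of the `ℕ`-sums `S` and `T`. -/
lemma phiK_one_eq (p : ℕ) :
    phiK p 1 = ((∑ u ∈ Finset.Ioo 1 p, Nat.choose (p + 1) u : ℕ) : ℚ) / ((p + 1 : ℕ) : ℚ) := by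
  unfold phiK
  rw [Nat.choose_succ_self_right]
  push_cast
  rfl

/-- **C-037 AT `q = 1` ON CORES**: for a simple, coloop-free matroid of rank `p ≥ 3` on `n ≥ p + 1` elements and
every non-loop `e`, `σ_{M ／ {e}}(p − 1, 1) ≤ σ_M(p, 1)`. -/
theorem contractMono_q_one [M.Finite] (hsimple : ∀ T ⊆ M.E, T.encard ≤ 2 → M.Indep T)
    {p : ℕ} (hp : 3 ≤ p) (hR : M.eRank = (p : ℕ∞)) (hcol : ∀ x, ¬ M.IsColoop x)
    (hn : p + 1 ≤ M.E.ncard) {e : α} (he : M.IsNonloop e) :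
    slack (M ／ {e}) (p - 1) 1 ≤ slack M p 1 := by
  have heI : M.Indep {e} := Matroid.indep_singleton.2 he
  have heE : e ∈ M.E := he.mem_ground
  set n := M.E.ncard with hn_def
  have hn1 : (M.E \ {e}).ncard = n - 1 := Set.ncard_sdiff_singleton_of_mem heE
  -- the identity `#Y_M(p,1) = #Y_{M∖e}(p,1) + #Y_{M/e}(p−1,1) + W_1(M/e)`
  obtain ⟨p', rfl⟩ : ∃ p', p = p' + 1 := ⟨p - 1, by omega⟩
  have hid := midCount_delete_contract_identity heI p' 0
  have hsplit := midCount_zero_eq (M := M ／ {e}) (p := p') (by omega)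
  rw [Nat.add_sub_cancel]
  -- the four bounds
  have hU : (topCount M (p' + 1) 1 : ℚ) ≤ n := by exact_mod_cast topCount_one_le_ncard hsimple hR
  have hY : ((∑ j ∈ Finset.Ioo 1 (p' + 1), Nat.choose (n - 1) j : ℕ) : ℚ) ≤ midCount (M ＼ {e}) (p' + 1) 1 := by
    have := sum_choose_le_midCount_delete hsimple e (p' + 1)
    rw [hn1] at this
    exact_mod_cast this
  have hW : ((n - 1 : ℕ) : ℚ) ≤ {A : Set α | A ⊆ (M ／ {e}).E ∧ (M ／ {e}).eRk A = ((1 : ℕ) : ℕ∞)}.ncard := by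
    have := ncard_le_levelOne_contract hsimple heI
    rw [hn1] at this
    exact_mod_cast this
  have hU' : ((n - 1 : ℕ) : ℚ) ≤ topCount (M ／ {e}) p' 1 := by
    have := ncard_le_topCount_contract hsimple (p := p' + 1) (by omega) hR hcol heI
    rw [hn1, Nat.add_sub_cancel] at this
    exact_mod_cast this
  -- the binomial inequality, cast to `ℚ`
  have hB := QOne.binom_ineq (p' + 1) n hp hn
  have hS := QOne.S_eq (p' + 1) hp
  rw [Nat.add_sub_cancel] at hB hS
  have hphi := phiK_one_eq (p' + 1)
  have hphi' : phiK p' 1 = ((∑ u ∈ Finset.Ioo 1 p', Nat.choose (p' + 1) u : ℕ) : ℚ) / ((p' + 1 : ℕ) : ℚ) := by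
    unfold phiK
    rw [Nat.choose_succ_self_right]
    push_cast
    rfl
  unfold slack
  rw [hid, hsplit]
  simp only [zero_add]
  push_cast
  rw [hphi, hphi']
  set S : ℕ := ∑ u ∈ Finset.Ioo 1 (p' + 1), Nat.choose (p' + 1 + 1) u with hS_def
  set T : ℕ := ∑ u ∈ Finset.Ioo 1 p', Nat.choose (p' + 1) u with hT_def
  set A : ℕ := ∑ j ∈ Finset.Ioo 1 (p' + 1), Nat.choose (n - 1) j with hA_def
  have hp1 : (0 : ℚ) < ((p' + 1 + 1 : ℕ) : ℚ) := by positivity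
  have hp0 : (0 : ℚ) < ((p' + 1 : ℕ) : ℚ) := by positivity
  have hBq : (n : ℚ) * (S : ℚ) * ((p' + 1 : ℕ) : ℚ) ≤
      ((p' + 1 : ℕ) : ℚ) * ((p' + 1 + 1 : ℕ) : ℚ) * (A : ℚ) +
        ((n - 1 : ℕ) : ℚ) * ((p' + 1 + 1 : ℕ) : ℚ) * (((p' + 1 : ℕ) : ℚ) + (T : ℚ)) := by
    exact_mod_cast hB
  have hΦS : (S : ℚ) / ((p' + 1 + 1 : ℕ) : ℚ) * (n : ℚ) ≤
      (A : ℚ) + ((n - 1 : ℕ) : ℚ) + (T : ℚ) / ((p' + 1 : ℕ) : ℚ) * ((n - 1 : ℕ) : ℚ) := by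
    rw [div_mul_eq_mul_div, div_mul_eq_mul_div, div_le_iff₀ hp1]
    have hrhs : (A : ℚ) + ((n - 1 : ℕ) : ℚ) + (T : ℚ) * ((n - 1 : ℕ) : ℚ) / ((p' + 1 : ℕ) : ℚ) =
        (((p' + 1 : ℕ) : ℚ) * A + ((n - 1 : ℕ) : ℚ) * (((p' + 1 : ℕ) : ℚ) + T)) / ((p' + 1 : ℕ) : ℚ) := by
      field_simp
      ring
    rw [hrhs, div_mul_eq_mul_div, le_div_iff₀ hp0]
    nlinarith [hBq]
  have hΦnn : (0 : ℚ) ≤ (S : ℚ) / ((p' + 1 + 1 : ℕ) : ℚ) := by positivity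
  have hΦ'nn : (0 : ℚ) ≤ (T : ℚ) / ((p' + 1 : ℕ) : ℚ) := by positivity
  have h1 := mul_le_mul_of_nonneg_left hU hΦnn
  have h2 := mul_le_mul_of_nonneg_left hU' hΦ'nn
  have hW' : ((n - 1 : ℕ) : ℚ) ≤ {A : Set α | A ⊆ (M ／ {e}).E ∧ (M ／ {e}).eRk A = 1}.ncard := by
    simpa only [Nat.cast_one] using hW
  linarith [h1, h2, hY, hW', hΦS]

end Matroid

end PercRepro
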